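import Literature.AlgebraicGeometry.Motives.AbelianVarietyRosatiLevelWeilPairing
import Literature.AlgebraicGeometry.Motives.AbelianVarietyWeilPairingGalois
import Literature.AlgebraicGeometry.Motives.AbelianVarietyWeilPairingRosatiTransport
import Literature.AlgebraicGeometry.Motives.AbelianVarietyWeilPairingAlgClosure
import Literature.AlgebraicGeometry.Motives.AbelianVarietyEndComplexGaloisTools
import HarnessLib

/-!
# The Rosati involution of a `K`-rational polarisation preserves `K`-rational endomorphisms — by Galois descent on the
# level Weil pairings (Mumford §20 (3), §21; Milne §16–§17; Shimura 1998 §5.1 Prop. 5)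

Layer `Literature/AlgebraicGeometry/Motives`, namespace `Literature.AlgebraicGeometry.Motives.AbelianVariety`.
THEOREMS ONLY: no definition, no instance, no named fact, no `sorry` (net Literature debt 0).

THE PRINT.  G. Shimura, *Abelian Varieties with Complex Multiplication and Modular Functions* (1998), §5.1 Prop. 5, proof
(p. 38): «`End_Q(B)` has an involution `ξ ↦ ξ'` with the property `tr(ξξ') > 0` … the involution maps `K` onto itself», and
§18.4 (18.4b) p. 123: the involution of `End_Q(A)` determined by an `L`-rational polarisation `𝒞`.  D. Mumford, *Abelian Varieties*
(1970), §20 p. 186 (3) «`e_n(f(x), ŷ) = e_n(x, f̂(ŷ))`», §21 Thm. 1.  J. S. Milne, *Abelian varieties* (1986), §16 p. 131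
(the pairings `ē_m` are pairings of Galois modules) and §17 (the Rosati involution is defined over the ground field).

WHAT IS PROVED (sequel of `Motives/AbelianVarietyRosatiLevelWeilPairing`, which reads the transcendental Rosati dual `f′` of
an endomorphism `f` of a complex abelian variety on the algebraic level pairings: `ē_N^Θ((d·f) P, Q) = ē_N^Θ(P, f′ Q)`).
For an abelian variety `B` over a field `K ⊆ ℂ`, its base change `B_ℂ`, a divisor `Θ₀` on `B` with `Θ = pr₁^*Θ₀`:

* §1 (any complex abelian variety `A` with a uniformisation) `map_add/zero/sub/nsmul_hom_apply` (endomorphisms on points),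
  **`eq_zero_of_forall_map_torsionPoints_eq_one`** — an endomorphism killing all `2`-power torsion points is `0` (Milne
  Lemma 12.6 `exists_eq_zsmul_of_forall_torsionPoints_self` + the integer matrix `ρ_r`), and **`eq_of_forall_weilPairingLevel_map_eq`**
  — UNIQUENESS OF THE LEVEL ADJOINT for an ample `Θ`: `ē^Θ_{2^k}(P, g Q) = ē^Θ_{2^k}(P, g′ Q)` for all `k, P, Q` forces `g = g′`
  (radical bound `weilPairingLevel_radical_pow_card_KTheta`, Lang VII §2 Prop. 4);
* §2 **`weilPairingLevel_map_galConj_of_forall`** — GALOIS TRANSPORT: if `f′` is a level adjoint of `d·(f₀)_ℂ` for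
  `Θ = pr₁^*Θ₀`, so is `σ • f′` for every `σ ∈ Aut(ℂ/K)` (`weilPairingLevel_galSmul`, `pointsEnd_galConj`,
  `galConj_baseChange`), with the bookkeeping `B(ℂ) ≃ B_ℂ(ℂ)` (`torsionPt`, `pointsMulEquiv_pointsEnd`, …);
* §3 **`galConj_rosatiDual_eq`** — the Rosati dual of `(f₀)_ℂ` (for the Riemann form of an ample `pr₁^*Θ₀`) is fixed by
  `Aut(ℂ/K)`, and **`exists_baseChange_eq_rosatiDual`** — for `K` countable it is `(f′₀)_ℂ` for some `f′₀ ∈ End(B)`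
  (`exists_baseChange_eq_of_forall_galConj_eq_complex`): «the involution maps `End_Q(B/K)` onto itself», WITHOUT the dual
  abelian variety.

USE (cell `hodgecm-mathlib`, D-0151, crux `HLiu418` = stmt-HodgeConjecture-24832, d6 card S2′ «G-ros»): consumed by
`ComplexMultiplication/EndFieldCMOfSimpleOverNumberField` (a full-degree endomorphism field of an abelian variety over a
number field is CM).  The file moves no book (HC_CM is proved only modulo the 7 printed citations until rung 0 closes).

## References
* [MumfordAV1970] D. Mumford, *Abelian Varieties* (1970), §20 (p. 186, property (3) of `e_n`; p. 189), §21 Thm. 1, §6 App. 1.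
* [Milne1986AbelianVarieties] J. S. Milne, *Abelian varieties*, in Cornell–Silverman (1986), Lemma 12.6, §16 (p. 131), §17.
* [Lang1983AbelianVarieties] S. Lang, *Abelian Varieties*, Ch. VII §2 Props. 2–4.
* [Shimura1998] G. Shimura, *Abelian Varieties with CM and Modular Functions* (1998), §5.1 Prop. 5 (p. 38), §18.4 (18.4b) (p. 123).
* [Lange2023AbelianVarietiesComplex] H. Lange, *Abelian Varieties over the Complex Numbers* (2023), §1.1.2 Prop. 1.1.6, §2.4.1.
-/

noncomputable section

open CategoryTheory AlgebraicGeometry Complex Cardinal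
open scoped Matrix
open Literature.Geometry.Kaehler Literature.Geometry.Kaehler.ComplexTorus
open Literature.NumberTheory.Transcendental Literature.AlgebraicGeometry.HodgeTheory

namespace Literature.AlgebraicGeometry.Motives.AbelianVariety

/-- The level Weil pairing only depends on the underlying points. [folklore] -/
private theorem weilPairingLevel_congr_points {L : Type} [Field L] {A : AbelianVariety L} {N : ℕ}
    [IsDominant (Hom.toSchemeHom ((N : ℤ) • 𝟙 A))] (Θ : CartierDivisor A.X.left)
    {P P' Q Q' : A.torsionPoints L N} (hP : (P : A.Points L) = P') (hQ : (Q : A.Points L) = Q') :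
    A.weilPairingLevel Θ P Q = A.weilPairingLevel Θ P' Q' := by
  cases Subtype.ext hP
  cases Subtype.ext hQ
  rfl

/-! ### §1 Uniqueness of the level-`N` adjoint on a complex abelian variety -/

section Unique

variable {A : AbelianVariety ℂ} {ι : Type} [Fintype ι] [DecidableEq ι] {Φ : (ι → ℝ) ≃L[ℝ] (Fin A.dim → ℂ)}
  {φ : ComplexTorus Φ → ComplexPoints A.X} (hφ : IsAnalytification (Fin A.dim → ℂ) A.X A.dim φ)
  (hadd : ∀ x y, φ (x + y) = φ x * φ y)

/-- `(u + u′)(Q) = u(Q) · u′(Q)` on points (`u, u′ ∈ End A`, the `Preadditive` endomorphism ring). [folklore] -/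
private theorem map_add_hom_apply (u u' : End A) (Q : A.Points ℂ) :
    AlgPoints.map (u + u').hom.hom.hom Q = AlgPoints.map u.hom.hom.hom Q * AlgPoints.map u'.hom.hom.hom Q := by
  have h := congrArg (fun t => Q ≫ t) (hom_hom_hom_add (show A ⟶ A from u) u')
  simp only at h
  rw [MonObj.comp_mul] at h
  exact h

/-- `0(Q) = 1` on points. [folklore] -/
private theorem map_zero_hom_apply (Q : A.Points ℂ) : AlgPoints.map (0 : End A).hom.hom.hom Q = 1 := by
  have h := map_add_hom_apply (0 : End A) 0 Q
  rw [add_zero] at h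
  exact mul_eq_left.mp h.symm

/-- `(u − u′)(Q) = u(Q) · u′(Q)⁻¹` on points. [folklore] -/
private theorem map_sub_hom_apply (u u' : End A) (Q : A.Points ℂ) :
    AlgPoints.map (u - u').hom.hom.hom Q = AlgPoints.map u.hom.hom.hom Q * (AlgPoints.map u'.hom.hom.hom Q)⁻¹ := by
  rw [eq_mul_inv_iff_mul_eq, ← map_add_hom_apply, sub_add_cancel]

/-- `(n • u)(Q) = u(Q)ⁿ` on points. [folklore] -/
private theorem map_nsmul_hom_apply (n : ℕ) (u : End A) (Q : A.Points ℂ) :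
    AlgPoints.map (n • u).hom.hom.hom Q = AlgPoints.map u.hom.hom.hom Q ^ n := by
  induction n with
  | zero => rw [zero_nsmul, pow_zero, map_zero_hom_apply]
  | succ n ih => rw [succ_nsmul, map_add_hom_apply, ih, pow_succ]

/-- The integer matrix of `d • u` is `d •` that of `u`. [folklore] -/
private theorem coe_endRingEquiv_symm_zsmul (d : ℤ) (u : End A) :
    (((endRingEquivOfAnalytification hφ hadd).symm (d • u) : endRingInt Φ) : Matrix ι ι ℤ) =
      d • (((endRingEquivOfAnalytification hφ hadd).symm u : endRingInt Φ) : Matrix ι ι ℤ) := by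
  rw [map_zsmul]
  rfl

/-- The integer matrix of `0` is `0`. [folklore] -/
private theorem coe_endRingEquiv_symm_zero :
    (((endRingEquivOfAnalytification hφ hadd).symm 0 : endRingInt Φ) : Matrix ι ι ℤ) = 0 := by
  rw [map_zero]
  rfl

omit [Fintype ι] [DecidableEq ι] in
/-- An integer divisible by every power of `2` is `0`. [folklore] -/
private theorem eq_zero_of_forall_two_pow_dvd {a : ℤ} (h : ∀ k : ℕ, (2 : ℤ) ^ k ∣ a) : a = 0 := by
  by_contra ha
  have hlt : a.natAbs < 2 ^ a.natAbs := Nat.lt_two_pow_self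
  have hdvd : 2 ^ a.natAbs ∣ a.natAbs := by
    have := Int.natAbs_dvd_natAbs.2 (h a.natAbs)
    simpa [Int.natAbs_pow] using this
  exact absurd (Nat.le_of_dvd (Int.natAbs_pos.2 ha) hdvd) (not_le.2 hlt)

include hφ hadd in
/-- **An endomorphism of a complex abelian variety killing all `2`-power torsion points is zero** (Milne Lemma 12.6:
it is divisible by every `2^k`, hence its integer matrix `ρ_r` is divisible by every `2^k`).
[cite: Milne1986AbelianVarieties, Lemma 12.6 (PDF p. 191)] [cite: Lange2023AbelianVarietiesComplex, §1.1.2 Prop. 1.1.6] -/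
theorem eq_zero_of_forall_map_torsionPoints_eq_one (h : End A)
    (hh : ∀ (k : ℕ) (Q : A.Points ℂ), Q ∈ A.torsionPoints ℂ ((2 ^ k : ℕ) : ℤ) → AlgPoints.map h.hom.hom.hom Q = 1) :
    h = 0 := by
  set eR := endRingEquivOfAnalytification hφ hadd with heR
  -- `h = 2^k • χ_k` for every `k`
  have hdiv : ∀ k : ℕ, ∃ χ : A ⟶ A, (show A ⟶ A from h) = ((2 ^ k : ℕ) : ℤ) • χ := fun k =>
    exists_eq_zsmul_of_forall_torsionPoints_self ((2 ^ k : ℕ) : ℤ)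
      (by rw [Int.cast_natCast, Nat.cast_pow]; exact pow_ne_zero k two_ne_zero) h
      (fun Q hQ => hh k Q hQ)
  -- hence every entry of `ρ_r(h)` is divisible by every `2^k`
  have hM : ((eR.symm h : endRingInt Φ) : Matrix ι ι ℤ) = 0 := by
    ext i j
    refine eq_zero_of_forall_two_pow_dvd fun k => ?_
    obtain ⟨χ, hχ⟩ := hdiv k
    refine ⟨((eR.symm χ : endRingInt Φ) : Matrix ι ι ℤ) i j, ?_⟩
    have hmat : ((eR.symm h : endRingInt Φ) : Matrix ι ι ℤ) =
        ((2 ^ k : ℕ) : ℤ) • ((eR.symm χ : endRingInt Φ) : Matrix ι ι ℤ) := by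
      rw [← coe_endRingEquiv_symm_zsmul hφ hadd]
      exact congrArg (fun u : End A => ((eR.symm u : endRingInt Φ) : Matrix ι ι ℤ)) hχ
    rw [hmat, Matrix.smul_apply, smul_eq_mul]
    push_cast
    ring
  have h0 : eR.symm h = 0 := Subtype.ext (by rw [hM]; rfl)
  simpa using congrArg eR h0

include hφ hadd in
/-- **Uniqueness of the level adjoint**: if two endomorphisms `g, g′` of a complex abelian variety have the same
level-`2^k` Weil pairings `ē^Θ(P, g Q) = ē^Θ(P, g′ Q)` against every `2^k`-torsion point `P`, for an AMPLE `Θ` and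
all `k`, then `g = g′` — the radical of `ē_{2^k}^Θ` is killed by `2^{#K(Θ)}` (Lang VII §2 Prop. 4,
`weilPairingLevel_radical_pow_card_KTheta`), so `2^{#K(Θ)} • (g − g′)` kills all `2`-power torsion.
[cite: Lang1983AbelianVarieties, Ch. VII §2 Prop. 4] [cite: MumfordAV1970, §20 (p. 186) and §6 Application 1 (p. 60)] -/
theorem eq_of_forall_weilPairingLevel_map_eq {Θ : CartierDivisor A.X.left} (hΘ : Θ.IsAmple) {g g' : End A}
    (h : ∀ (k : ℕ) [IsDominant (Hom.toSchemeHom (((2 ^ k : ℕ) : ℤ) • 𝟙 A))]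
      (P Q : A.torsionPoints ℂ ((2 ^ k : ℕ) : ℤ)),
      A.weilPairingLevel Θ P ⟨AlgPoints.map g.hom.hom.hom Q.1, map_mem_torsionPoints g Q.2⟩ =
        A.weilPairingLevel Θ P ⟨AlgPoints.map g'.hom.hom.hom Q.1, map_mem_torsionPoints g' Q.2⟩) :
    g = g' := by
  set c : ℕ := Nat.card (A.KTheta Θ) with hc
  suffices hzero : (2 ^ c) • (g - g') = 0 by
    have h2 : ((2 ^ c : ℕ) : ℤ) • (g - g') = 0 := by rwa [natCast_zsmul]
    set eR := endRingEquivOfAnalytification hφ hadd with heR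
    have hmat : ((2 ^ c : ℕ) : ℤ) • ((eR.symm (g - g') : endRingInt Φ) : Matrix ι ι ℤ) = 0 := by
      rw [← coe_endRingEquiv_symm_zsmul hφ hadd, h2, coe_endRingEquiv_symm_zero hφ hadd]
    rw [smul_eq_zero] at hmat
    rcases hmat with hmat | hmat
    · exact absurd hmat (by exact_mod_cast pow_ne_zero c two_ne_zero)
    · have h0 : eR.symm (g - g') = 0 := Subtype.ext (by rw [hmat]; rfl)
      exact sub_eq_zero.1 (by simpa using congrArg eR h0)
  refine eq_zero_of_forall_map_torsionPoints_eq_one hφ hadd _ fun k Q hQ => ?_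
  haveI : IsDominant (Hom.toSchemeHom (((2 ^ k : ℕ) : ℤ) • 𝟙 A)) :=
    isDominant_toSchemeHom_zsmul_of_ne_zero A (by exact_mod_cast pow_ne_zero k two_ne_zero)
  -- the radical bound applied to `(g − g′) Q`
  have hrad := A.weilPairingLevel_radical_pow_card_KTheta hΘ Nat.prime_two (by norm_num) k
    ⟨AlgPoints.map (g - g').hom.hom.hom Q, map_mem_torsionPoints (g - g') hQ⟩ fun P => by
      have hP := h k P ⟨Q, hQ⟩
      have hsub : (⟨AlgPoints.map (g - g').hom.hom.hom Q, map_mem_torsionPoints (g - g') hQ⟩ :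
          A.torsionPoints ℂ ((2 ^ k : ℕ) : ℤ)) =
          ⟨AlgPoints.map g.hom.hom.hom Q, map_mem_torsionPoints g hQ⟩ *
            (⟨AlgPoints.map g'.hom.hom.hom Q, map_mem_torsionPoints g' hQ⟩)⁻¹ :=
        Subtype.ext (map_sub_hom_apply g g' Q)
      rw [hsub, weilPairingLevel_mul_right, weilPairingLevel_inv_right, hP, mul_inv_cancel₀]
      exact weilPairingLevel_ne_zero _ _ _
  rw [map_nsmul_hom_apply]
  exact hrad

end Unique

/-! ### §2 Galois transport: if `f′` is a level adjoint of `(d·f₀)_ℂ` for `pr₁^*Θ₀`, so is every `σ • f′` -/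

section Galois

variable {K : Type} [Field K] [Algebra K ℂ] (B : AbelianVariety K)

/-- `u(x)` is `N`-torsion when `x` is (`u ∈ End(B_ℂ)` acting on `B(ℂ)`). [folklore] -/
private theorem pointsEnd_pow_eq_one {N : ℕ} (u : End (B.baseChange ℂ)) {x : B.Points ℂ} (hx : x ^ N = 1) :
    B.pointsEnd ℂ u x ^ N = 1 := by
  rw [← map_pow, hx, map_one]

/-- The torsion point of `B_ℂ(ℂ)` attached to `u(x)` is `u` applied to the one attached to `x`. [folklore] -/
private theorem coe_torsionPt_pointsEnd {N : ℕ} (u : End (B.baseChange ℂ)) {x : B.Points ℂ} (hx : x ^ N = 1) :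
    ((B.torsionPt ℂ (B.pointsEnd_pow_eq_one u hx) : (B.baseChange ℂ).torsionPoints ℂ N) :
        (B.baseChange ℂ).Points ℂ) =
      AlgPoints.map u.hom.hom.hom ((B.torsionPt ℂ hx : (B.baseChange ℂ).torsionPoints ℂ N) :
        (B.baseChange ℂ).Points ℂ) := by
  change B.pointsMulEquiv ℂ ((B.pointsMulEquiv ℂ).symm (B.pointsMulEquiv ℂ x ≫ u.hom.hom.hom)) = _
  rw [MulEquiv.apply_symm_apply]
  rfl

/-- … as an equality of torsion points. [folklore] -/
private theorem torsionPt_pointsEnd {N : ℕ} (u : End (B.baseChange ℂ)) {x : B.Points ℂ} (hx : x ^ N = 1) :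
    B.torsionPt ℂ (B.pointsEnd_pow_eq_one u hx) =
      ⟨AlgPoints.map u.hom.hom.hom (B.torsionPt ℂ hx).1, map_mem_torsionPoints u (B.torsionPt ℂ hx).2⟩ :=
  Subtype.ext (B.coe_torsionPt_pointsEnd u hx)

/-- Every `N`-torsion point of `B_ℂ(ℂ)` is the torsion point attached to an `ℂ`-point of `B` with `x ^ N = 1`. [folklore] -/
private theorem symm_pow_eq_one {N : ℕ} (P : (B.baseChange ℂ).torsionPoints ℂ N) :
    (B.pointsMulEquiv ℂ).symm P.1 ^ N = 1 := by
  rw [← map_pow, coe_torsionPoints_pow_eq_one P, map_one]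

/-- … namely `torsionPt` of `pointsMulEquiv⁻¹ P`. [folklore] -/
private theorem torsionPt_symm {N : ℕ} (P : (B.baseChange ℂ).torsionPoints ℂ N) :
    B.torsionPt ℂ (B.symm_pow_eq_one P) = P :=
  Subtype.ext ((B.pointsMulEquiv ℂ).apply_symm_apply P.1)

/-- Two torsion points with the same underlying point are equal. [folklore] -/
private theorem torsionPt_congr {N : ℕ} {x y : B.Points ℂ} (hx : x ^ N = 1) (hy : y ^ N = 1) (h : x = y) :
    B.torsionPt ℂ hx = B.torsionPt ℂ hy := by
  subst h
  rfl

/-- `B(ℂ) ≃ B_ℂ(ℂ)` carries the action of `u ∈ End(B_ℂ)` on `B(ℂ)` (`pointsEnd`) to `P ↦ u P`. [folklore] -/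
private theorem pointsMulEquiv_pointsEnd (u : End (B.baseChange ℂ)) (x : B.Points ℂ) :
    B.pointsMulEquiv ℂ (B.pointsEnd ℂ u x) = AlgPoints.map u.hom.hom.hom (B.pointsMulEquiv ℂ x) :=
  (B.pointsMulEquiv ℂ).apply_symm_apply _

/-- Galois conjugation commutes with integer multiples: `σ • (d • r) = d • (σ • r)`. [folklore] -/
private theorem galConj_zsmul (σ : ℂ ≃ₐ[K] ℂ) (d : ℤ) (r : End (B.baseChange ℂ)) :
    B.galConj ℂ σ (d • r) = d • B.galConj ℂ σ r :=
  map_zsmul (AddMonoidHom.mk' (fun r : End (B.baseChange ℂ) => B.galConj ℂ σ r) (B.galConj_add ℂ σ)) d r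

/-- **Galois transport of the level adjunction** (Milne §16: the `ē_m` are Galois equivariant; Mumford §20 (3)): let `Θ = pr₁^*Θ₀`
for a divisor `Θ₀` of `B` over `K`, `f = (f₀)_ℂ` for `f₀ ∈ End(B)`, and suppose `f′ ∈ End(B_ℂ)` satisfies
`ē_N^Θ((d·f) P, Q) = ē_N^Θ(P, f′ Q)` for all `N` and all `P, Q ∈ B_ℂ[N](ℂ)`.  Then so does the Galois conjugate
`σ • f′` for every `σ ∈ Aut(ℂ/K)`: conjugate the identity at `(σ⁻¹P, σ⁻¹Q)` by `σ`, using `ē(σP, σQ) = σ ē(P, Q)`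
(`weilPairingLevel_galSmul`), `(σ • u)(σ x) = σ (u x)` (`pointsEnd_galConj`) and `σ • (d·f) = d·f` (`galConj_baseChange`).
[cite: Milne1986AbelianVarieties, §16 (p. 131, the pairings ē_m)] [cite: MumfordAV1970, §20 (p. 186, property (3) of e_n)]
[cite: Lang1983AbelianVarieties, Ch. VII §2 Props. 2–3] -/
theorem weilPairingLevel_map_galConj_of_forall (Θ₀ : CartierDivisor B.X.left) (f₀ : End B) (d : ℤ)
    {f' : End (B.baseChange ℂ)}
    (hadj : ∀ (N : ℕ) [IsDominant (Hom.toSchemeHom ((N : ℤ) • 𝟙 (B.baseChange ℂ)))]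
      (P Q : (B.baseChange ℂ).torsionPoints ℂ N),
      (B.baseChange ℂ).weilPairingLevel (Θ₀.pullback (B.fstX ℂ))
          ⟨AlgPoints.map (d • (Hom.baseChange ℂ f₀ : End (B.baseChange ℂ))).hom.hom.hom P.1,
            map_mem_torsionPoints _ P.2⟩ Q =
        (B.baseChange ℂ).weilPairingLevel (Θ₀.pullback (B.fstX ℂ)) P
          ⟨AlgPoints.map f'.hom.hom.hom Q.1, map_mem_torsionPoints f' Q.2⟩)
    (σ : ℂ ≃ₐ[K] ℂ) (N : ℕ) [IsDominant (Hom.toSchemeHom ((N : ℤ) • 𝟙 (B.baseChange ℂ)))]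
    (P Q : (B.baseChange ℂ).torsionPoints ℂ N) :
    (B.baseChange ℂ).weilPairingLevel (Θ₀.pullback (B.fstX ℂ))
        ⟨AlgPoints.map (d • (Hom.baseChange ℂ f₀ : End (B.baseChange ℂ))).hom.hom.hom P.1,
          map_mem_torsionPoints _ P.2⟩ Q =
      (B.baseChange ℂ).weilPairingLevel (Θ₀.pullback (B.fstX ℂ)) P
        ⟨AlgPoints.map (B.galConj ℂ σ f').hom.hom.hom Q.1, map_mem_torsionPoints (B.galConj ℂ σ f') Q.2⟩ := by
  set f : End (B.baseChange ℂ) := Hom.baseChange ℂ f₀ with hf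
  have hΘ : ∀ τ : ℂ ≃ₐ[K] ℂ, (((Θ₀.pullback (B.fstX ℂ)).pullback (B.galX ℂ τ)).SameDivisor (Θ₀.pullback (B.fstX ℂ))) :=
    fun τ => B.pullback_fstX_galX_sameDivisor ℂ Θ₀ τ
  -- `ℂ`-points of `B` underlying `P`, `Q`, and their `σ⁻¹`-translates
  have hr := B.symm_pow_eq_one P
  have hs := B.symm_pow_eq_one Q
  set e := B.pointsMulEquiv ℂ with he
  set r := e.symm P.1 with hrdef
  set s := e.symm Q.1 with hsdef
  have hr' := B.smul_pow_eq_one ℂ σ⁻¹ hr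
  have hs' := B.smul_pow_eq_one ℂ σ⁻¹ hs
  have heP : e r = P.1 := e.apply_symm_apply P.1
  have heQ : e s = Q.1 := e.apply_symm_apply Q.1
  -- `σ` fixes `d • f`
  have hσf : B.galConj ℂ σ (d • f) = d • f := by
    rw [galConj_zsmul, hf, galConj_baseChange]
    rfl
  have k1 : σ • B.pointsEnd ℂ (d • f) (σ⁻¹ • r) = B.pointsEnd ℂ (d • f) r := by
    rw [← B.pointsEnd_galConj ℂ σ (d • f) r, hσf]
  have k4 : σ • B.pointsEnd ℂ f' (σ⁻¹ • s) = B.pointsEnd ℂ (B.galConj ℂ σ f') s := by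
    rw [B.pointsEnd_galConj ℂ σ f' s]
  -- the identity at `(σ⁻¹ r, σ⁻¹ s)`, read on `torsionPt`s
  have h1 : (B.baseChange ℂ).weilPairingLevel (Θ₀.pullback (B.fstX ℂ))
        (B.torsionPt ℂ (B.pointsEnd_pow_eq_one (d • f) hr')) (B.torsionPt ℂ hs') =
      (B.baseChange ℂ).weilPairingLevel (Θ₀.pullback (B.fstX ℂ))
        (B.torsionPt ℂ hr') (B.torsionPt ℂ (B.pointsEnd_pow_eq_one f' hs')) :=
    (weilPairingLevel_congr_points _ (B.pointsMulEquiv_pointsEnd (d • f) (σ⁻¹ • r)) rfl).trans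
      ((hadj N (B.torsionPt ℂ hr') (B.torsionPt ℂ hs')).trans
        (weilPairingLevel_congr_points _ rfl (B.pointsMulEquiv_pointsEnd f' (σ⁻¹ • s)).symm))
  -- conjugate by `σ`
  calc (B.baseChange ℂ).weilPairingLevel (Θ₀.pullback (B.fstX ℂ))
          ⟨AlgPoints.map (d • f).hom.hom.hom P.1, map_mem_torsionPoints _ P.2⟩ Q
      = (B.baseChange ℂ).weilPairingLevel (Θ₀.pullback (B.fstX ℂ))
          (B.torsionPt ℂ (B.smul_pow_eq_one ℂ σ (B.pointsEnd_pow_eq_one (d • f) hr')))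
          (B.torsionPt ℂ (B.smul_pow_eq_one ℂ σ hs')) := by
        refine weilPairingLevel_congr_points _ ?_ ?_
        · change AlgPoints.map (d • f).hom.hom.hom P.1 = e (σ • B.pointsEnd ℂ (d • f) (σ⁻¹ • r))
          rw [k1, pointsMulEquiv_pointsEnd, heP]
        · change Q.1 = e (σ • (σ⁻¹ • s))
          rw [smul_inv_smul, heQ]
    _ = σ ((B.baseChange ℂ).weilPairingLevel (Θ₀.pullback (B.fstX ℂ))
          (B.torsionPt ℂ (B.pointsEnd_pow_eq_one (d • f) hr')) (B.torsionPt ℂ hs')) :=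
        B.weilPairingLevel_galSmul ℂ _ hΘ σ _ _
    _ = σ ((B.baseChange ℂ).weilPairingLevel (Θ₀.pullback (B.fstX ℂ))
          (B.torsionPt ℂ hr') (B.torsionPt ℂ (B.pointsEnd_pow_eq_one f' hs'))) := by rw [h1]
    _ = (B.baseChange ℂ).weilPairingLevel (Θ₀.pullback (B.fstX ℂ))
          (B.torsionPt ℂ (B.smul_pow_eq_one ℂ σ hr'))
          (B.torsionPt ℂ (B.smul_pow_eq_one ℂ σ (B.pointsEnd_pow_eq_one f' hs'))) :=
        (B.weilPairingLevel_galSmul ℂ _ hΘ σ _ _).symm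
    _ = (B.baseChange ℂ).weilPairingLevel (Θ₀.pullback (B.fstX ℂ)) P
          ⟨AlgPoints.map (B.galConj ℂ σ f').hom.hom.hom Q.1, map_mem_torsionPoints (B.galConj ℂ σ f') Q.2⟩ := by
        refine weilPairingLevel_congr_points _ ?_ ?_
        · change e (σ • (σ⁻¹ • r)) = P.1
          rw [smul_inv_smul, heP]
        · change e (σ • B.pointsEnd ℂ f' (σ⁻¹ • s)) = AlgPoints.map (B.galConj ℂ σ f').hom.hom.hom Q.1
          rw [k4, pointsMulEquiv_pointsEnd, heQ]

end Galois

/-! ### §3 Descent: the Rosati dual of `(f₀)_ℂ` is Galois-fixed, hence of the form `(f′₀)_ℂ` -/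

section Descent

variable {K : Type} [Field K] [Algebra K ℂ] (B : AbelianVariety K)
  {ι : Type} [Fintype ι] [DecidableEq ι] {Φ : (ι → ℝ) ≃L[ℝ] (Fin (B.baseChange ℂ).dim → ℂ)}
  {φ : ComplexTorus Φ → ComplexPoints (B.baseChange ℂ).X}
  (hφ : IsAnalytification (Fin (B.baseChange ℂ).dim → ℂ) (B.baseChange ℂ).X (B.baseChange ℂ).dim φ)
  (hadd : ∀ x y, φ (x + y) = φ x * φ y)

include hφ hadd in
/-- **The Rosati dual of a `K`-rational endomorphism is fixed by `Aut(ℂ/K)`.**  Let `B/K` with `K ⊆ ℂ`, `Θ₀` a divisor of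
`B` whose pullback `Θ = pr₁^*Θ₀` to `B_ℂ` is ample, `(Φ, φ, p)` a uniformisation of `B_ℂ` with an Appell–Humbert datum of
`[𝒪(Θ)^an]` whose form is a Riemann form, `G` its rational Gram matrix.  If `f′ ∈ End(B_ℂ)` is the Rosati dual of `(f₀)_ℂ`
with denominator `d` (`ρ_r(f′) = d · rosati G ρ_r((f₀)_ℂ)`), then `σ • f′ = f′` for every `σ ∈ Aut(ℂ/K)`: both are
level adjoints of `d·(f₀)_ℂ` for `ē_N^Θ` (`weilPairingLevel_map_rosatiDual`, `weilPairingLevel_map_galConj_of_forall`),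
and level adjoints are unique (`eq_of_forall_weilPairingLevel_map_eq`).
[cite: MumfordAV1970, §20 (p. 186, property (3) of e_n) and §21 Thm. 1] [cite: Milne1986AbelianVarieties, §16 (p. 131) and §17]
[cite: Shimura1998, §5.1 Prop. 5 (p. 38) and §1.3 (the involution of a polarised abelian variety)] -/
theorem galConj_rosatiDual_eq {Θ₀ : CartierDivisor B.X.left} (hΘ : (Θ₀.pullback (B.fstX ℂ)).IsAmple)
    (p : AHData Φ) (hp : AHData.toPic p = picClass (cartierDivisorLineBundle hφ (Θ₀.pullback (B.fstX ℂ))))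
    (hR : IsRiemannForm Φ p.form) {G : Matrix ι ι ℚ} (hG : G.map (Rat.cast : ℚ → ℝ) = latticeGram Φ p.form)
    (f₀ : End B) {f' : End (B.baseChange ℂ)} {d : ℤ}
    (hff' : ((endToEndAlgRat hφ hadd f' : endAlgRat Φ) : Matrix ι ι ℚ) =
      d • rosati G ((endToEndAlgRat hφ hadd (Hom.baseChange ℂ f₀ : End (B.baseChange ℂ)) : endAlgRat Φ) :
        Matrix ι ι ℚ))
    (σ : ℂ ≃ₐ[K] ℂ) : B.galConj ℂ σ f' = f' := by
  have hadj : ∀ (N : ℕ) [IsDominant (Hom.toSchemeHom ((N : ℤ) • 𝟙 (B.baseChange ℂ)))]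
      (P Q : (B.baseChange ℂ).torsionPoints ℂ N),
      (B.baseChange ℂ).weilPairingLevel (Θ₀.pullback (B.fstX ℂ))
          ⟨AlgPoints.map (d • (Hom.baseChange ℂ f₀ : End (B.baseChange ℂ))).hom.hom.hom P.1,
            map_mem_torsionPoints _ P.2⟩ Q =
        (B.baseChange ℂ).weilPairingLevel (Θ₀.pullback (B.fstX ℂ)) P
          ⟨AlgPoints.map f'.hom.hom.hom Q.1, map_mem_torsionPoints f' Q.2⟩ :=
    fun N _ P Q => weilPairingLevel_map_rosatiDual hφ hadd (Θ₀.pullback (B.fstX ℂ)) p hp hR hG hff' P Q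
  refine eq_of_forall_weilPairingLevel_map_eq hφ hadd hΘ fun k _ P Q => ?_
  rw [← B.weilPairingLevel_map_galConj_of_forall Θ₀ f₀ d hadj σ _ P Q, hadj]

include hφ hadd in
/-- **The Rosati involution preserves `K`-rational endomorphisms**: for every `f₀ ∈ End(B)` there are `d ∈ ℤ ∖ 0` and
`f′₀ ∈ End(B)` — over `K` — with `ρ_r((f′₀)_ℂ) = d · rosati G ρ_r((f₀)_ℂ)`, for `K ⊆ ℂ` countable (e.g. a number field):
the Rosati dual of `(f₀)_ℂ` (`exists_rosatiDual`) is `Aut(ℂ/K)`-fixed (`galConj_rosatiDual_eq`), hence descends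
(`exists_baseChange_eq_of_forall_galConj_eq_complex`).  This is the statement «the involution determined by an `L`-rational
polarisation maps `End_Q(A/L)` onto itself» without the dual abelian variety.
[cite: Shimura1998, §5.1 Prop. 5 (p. 38) and §18.4 (18.4b) (p. 123)] [cite: MumfordAV1970, §20 (p. 189, the Rosati involution) and §21 Thm. 1]
[cite: Milne1986AbelianVarieties, §17 (the Rosati involution)] -/
theorem exists_baseChange_eq_rosatiDual (hK : #K ≤ ℵ₀) {Θ₀ : CartierDivisor B.X.left}
    (hΘ : (Θ₀.pullback (B.fstX ℂ)).IsAmple)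
    (p : AHData Φ) (hp : AHData.toPic p = picClass (cartierDivisorLineBundle hφ (Θ₀.pullback (B.fstX ℂ))))
    (hR : IsRiemannForm Φ p.form) {G : Matrix ι ι ℚ} (hG : G.map (Rat.cast : ℚ → ℝ) = latticeGram Φ p.form)
    (f₀ : End B) :
    ∃ (d : ℤ) (f'₀ : End B), d ≠ 0 ∧
      ((endToEndAlgRat hφ hadd (Hom.baseChange ℂ f'₀ : End (B.baseChange ℂ)) : endAlgRat Φ) : Matrix ι ι ℚ) =
        d • rosati G ((endToEndAlgRat hφ hadd (Hom.baseChange ℂ f₀ : End (B.baseChange ℂ)) : endAlgRat Φ) :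
          Matrix ι ι ℚ) := by
  obtain ⟨d, f', hd, hff'⟩ := exists_rosatiDual hφ hadd hR hG (Hom.baseChange ℂ f₀ : End (B.baseChange ℂ))
  obtain ⟨f'₀, hf'₀⟩ := B.exists_baseChange_eq_of_forall_galConj_eq_complex hK f'
    (fun σ => B.galConj_rosatiDual_eq hφ hadd hΘ p hp hR hG f₀ hff' σ)
  refine ⟨d, f'₀, hd, ?_⟩
  rw [show (Hom.baseChange ℂ f'₀ : End (B.baseChange ℂ)) = f' from hf'₀]
  exact hff'

end Descent

end Literature.AlgebraicGeometry.Motives.AbelianVariety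

end
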